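import Mathlib
import HarnessLib
import Summits.KontsevichZagierPeriods.Zeta5Search.DougallParameterHolomorphy
import Literature.Analysis.Complex.ConeTubeIdentity

/-!
# ζ(5) search — Zudilin's (9) and the case `k = 1` of his theorem on the FULL positive range (cell `pub-zeta5`, ct-1 g26)

HONEST FRAMING: systematic search; no irrationality claim unless kernel-certified.  Identities of special functions;
nothing here is an irrationality result; no named fact of the tree is discharged (the typed
`Zudilin2002.vwp_eq_integral_of_pos` quantifies over every `k ≥ 1`; this file settles its instance `k = 1` under exactly
the typed hypotheses).

`DougallZudilinForm.zudilin_nine` gives (9) for real `hⱼ > 0` on the Carlson sub-range `2(h₁+h₂) < 1+h₀`, `2h₃ < 1+h₀`.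
Here the sub-range restriction is removed by analytic continuation in the parameter `h₁ ∈ ℂ` on the convex domain
`{0 < Re w < 1+h₀−h₂−h₃}` (holomorphy of the series side: `DougallParameterHolomorphy.differentiableOn_series`; identity
theorem from the real points: `Literature.Analysis.Complex.eqOn_of_isPreconnected_of_eq_ofReal`) followed by the symmetry
of (9) in `(h₁,h₂,h₃)` (at most one of them reaches `(1+h₀)/2`):
* `zudilin_nine_of_lt`, `zudilin_nine'` — (9) for all real `h₀,h₁,h₂,h₃ > 0` with `h₁+h₂+h₃ < 1+h₀` [cite: Bailey1935, §4.4 (1)];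
* `vwpSeries_three_eq'` — the typed `Zudilin2002.vwpSeries 3 h` in closed form under the same hypotheses;
* `vwp_eq_integral_one`, `vwp_eq_integral_of_pos_one` — the instance `k = 1` of the typed `vwp_eq_integral_of_pos`
  (eqs. (9)–(11) of Zudilin's note), the second verbatim in the typed statement's hypotheses.
Theorems only (no new definitions).
-/

noncomputable section

namespace Summit.KontsevichZagierPeriods.Zeta5Search.DougallFullRange

open Finset Filter Set Metric
open Summit.KontsevichZagierPeriods.Zeta5Search.DougallZudilinForm (zudilin_nine)
open Summit.KontsevichZagierPeriods.Zeta5Search.DougallParameterHolomorphy (differentiableOn_series)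
open Literature.NumberTheory.Irrationality.Zudilin2002 (vwpSeries sorokinIntegral)

/-! ### 4. Holomorphy of the Gamma side and the continuation -/

/-- The Gamma side of (9) is holomorphic in `w = h₁` on `D = {0 < Re w < 1+h₀−h₂−h₃}` (`h₂, h₃ > 0`). -/
theorem differentiableOn_gammaSide (h₀ h₂ h₃ : ℝ) (hh₂ : 0 < h₂) (hh₃ : 0 < h₃) :
    DifferentiableOn ℂ (fun w : ℂ => Complex.Gamma w * Complex.Gamma h₂ * Complex.Gamma h₃ *
        Complex.Gamma ((h₀ : ℂ) - w - h₂ - h₃ + 1) /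
        (Complex.Gamma ((h₀ : ℂ) - w - h₂ + 1) * Complex.Gamma ((h₀ : ℂ) - w - h₃ + 1) *
          Complex.Gamma ((h₀ : ℂ) - h₂ - h₃ + 1)))
      {w : ℂ | 0 < w.re ∧ w.re < 1 + h₀ - h₂ - h₃} := by
  intro w hw
  obtain ⟨hw, hw'⟩ := hw
  have pole : ∀ {s : ℂ}, 0 < s.re → ∀ m : ℕ, s ≠ -(m : ℂ) := by
    intro s hs m h
    have := congrArg Complex.re h
    simp at this
    linarith [m.cast_nonneg (α := ℝ)]
  have dw : DifferentiableAt ℂ Complex.Gamma w := Complex.differentiableAt_Gamma _ (pole hw)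
  have dN : DifferentiableAt ℂ (fun w : ℂ => Complex.Gamma ((h₀ : ℂ) - w - h₂ - h₃ + 1)) w :=
    (Complex.differentiableAt_Gamma _ (pole (by simp; linarith))).comp w
      (((((differentiableAt_const _).sub differentiableAt_id).sub_const _).sub_const _).add_const _)
  have dD1 : DifferentiableAt ℂ (fun w : ℂ => Complex.Gamma ((h₀ : ℂ) - w - h₂ + 1)) w :=
    (Complex.differentiableAt_Gamma _ (pole (by simp; linarith))).comp w
      ((((differentiableAt_const _).sub differentiableAt_id).sub_const _).add_const _)
  have dD2 : DifferentiableAt ℂ (fun w : ℂ => Complex.Gamma ((h₀ : ℂ) - w - h₃ + 1)) w :=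
    (Complex.differentiableAt_Gamma _ (pole (by simp; linarith))).comp w
      ((((differentiableAt_const _).sub differentiableAt_id).sub_const _).add_const _)
  refine (DifferentiableAt.div (((dw.mul_const _).mul_const _).mul dN) ((dD1.mul dD2).mul_const _)
    ?_).differentiableWithinAt
  have g1 : Complex.Gamma ((h₀ : ℂ) - w - h₂ + 1) ≠ 0 := Complex.Gamma_ne_zero (pole (by simp; linarith))
  have g2 : Complex.Gamma ((h₀ : ℂ) - w - h₃ + 1) ≠ 0 := Complex.Gamma_ne_zero (pole (by simp; linarith))
  have g3 : Complex.Gamma ((h₀ : ℂ) - h₂ - h₃ + 1) ≠ 0 := Complex.Gamma_ne_zero (pole (by simp; linarith))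
  exact mul_ne_zero (mul_ne_zero g1 g2) g3

/-- **(9) beyond the Carlson range by continuation in `h₁`**: for real `h₀, h₂, h₃ > 0` with `2h₂ < 1+h₀`, `2h₃ < 1+h₀`
and every real `h₁ > 0` with `h₁+h₂+h₃ < 1+h₀`, Zudilin's (9) holds.  Both sides are holomorphic in `w = h₁` on the convex
domain `D = {0 < Re w < 1+h₀−h₂−h₃}` and agree at the real points `0 < w < min(1+h₀−h₂−h₃, (1+h₀)/2−h₂)` by `zudilin_nine`. -/
theorem zudilin_nine_of_lt (h₀ h₂ h₃ : ℝ) (hh₀ : 0 < h₀) (hh₂ : 0 < h₂) (hh₃ : 0 < h₃) (h2lt : 2 * h₂ < 1 + h₀)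
    (h3lt : 2 * h₃ < 1 + h₀) (h₁ : ℝ) (hh₁ : 0 < h₁) (hs : h₁ + h₂ + h₃ < 1 + h₀) :
    ∑' μ : ℕ, ((h₀ : ℂ) + 2 * μ) *
        (Complex.Gamma ((h₀ : ℂ) + μ) * Complex.Gamma ((h₁ : ℂ) + μ) * Complex.Gamma ((h₂ : ℂ) + μ) *
          Complex.Gamma ((h₃ : ℂ) + μ)) /
        (Complex.Gamma ((μ : ℂ) + 1) * Complex.Gamma ((h₀ : ℂ) - h₁ + 1 + μ) * Complex.Gamma ((h₀ : ℂ) - h₂ + 1 + μ) *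
          Complex.Gamma ((h₀ : ℂ) - h₃ + 1 + μ)) =
      Complex.Gamma h₁ * Complex.Gamma h₂ * Complex.Gamma h₃ * Complex.Gamma ((h₀ : ℂ) - h₁ - h₂ - h₃ + 1) /
        (Complex.Gamma ((h₀ : ℂ) - h₁ - h₂ + 1) * Complex.Gamma ((h₀ : ℂ) - h₁ - h₃ + 1) *
          Complex.Gamma ((h₀ : ℂ) - h₂ - h₃ + 1)) := by
  set S : ℂ → ℂ := fun w : ℂ => ∑' μ : ℕ, ((h₀ : ℂ) + 2 * μ) *
        (Complex.Gamma ((h₀ : ℂ) + μ) * Complex.Gamma (w + μ) * Complex.Gamma ((h₂ : ℂ) + μ) *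
          Complex.Gamma ((h₃ : ℂ) + μ)) /
        (Complex.Gamma ((μ : ℂ) + 1) * Complex.Gamma ((h₀ : ℂ) - w + 1 + μ) * Complex.Gamma ((h₀ : ℂ) - h₂ + 1 + μ) *
          Complex.Gamma ((h₀ : ℂ) - h₃ + 1 + μ)) with hS
  set G : ℂ → ℂ := fun w : ℂ => Complex.Gamma w * Complex.Gamma h₂ * Complex.Gamma h₃ *
        Complex.Gamma ((h₀ : ℂ) - w - h₂ - h₃ + 1) /
        (Complex.Gamma ((h₀ : ℂ) - w - h₂ + 1) * Complex.Gamma ((h₀ : ℂ) - w - h₃ + 1) *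
          Complex.Gamma ((h₀ : ℂ) - h₂ - h₃ + 1)) with hG
  set D : Set ℂ := {w : ℂ | 0 < w.re ∧ w.re < 1 + h₀ - h₂ - h₃} with hD
  set c' : ℝ := min (1 + h₀ - h₂ - h₃) ((1 + h₀) / 2 - h₂) with hc'
  have hc'pos : 0 < c' := lt_min (by linarith) (by linarith)
  have hc'1 : c' ≤ 1 + h₀ - h₂ - h₃ := min_le_left _ _
  have hc'2 : c' ≤ (1 + h₀) / 2 - h₂ := min_le_right _ _
  set D' : Set ℂ := {w : ℂ | 0 < w.re ∧ w.re < c'} with hD'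
  have hSD : DifferentiableOn ℂ S D := differentiableOn_series h₀ h₂ h₃ hh₀ hh₂ hh₃
  have hGD : DifferentiableOn ℂ G D := differentiableOn_gammaSide h₀ h₂ h₃ hh₂ hh₃
  have hsub : D' ⊆ D := fun w hw => ⟨hw.1, lt_of_lt_of_le hw.2 hc'1⟩
  have hDo : IsOpen D :=
    (isOpen_lt continuous_const Complex.continuous_re).inter (isOpen_lt Complex.continuous_re continuous_const)
  have hD'o : IsOpen D' :=
    (isOpen_lt continuous_const Complex.continuous_re).inter (isOpen_lt Complex.continuous_re continuous_const)
  have hDc : IsPreconnected D := ((convex_halfSpace_re_gt 0).inter (convex_halfSpace_re_lt _)).isPreconnected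
  have hD'c : IsPreconnected D' := ((convex_halfSpace_re_gt 0).inter (convex_halfSpace_re_lt _)).isPreconnected
  have hx₀' : ((c' / 2 : ℝ) : ℂ) ∈ D' := ⟨by simp; linarith, by simp; linarith⟩
  -- agreement on `D'` from the real points (Carlson range)
  have hEq' : EqOn S G D' := by
    refine Literature.Analysis.Complex.eqOn_of_isPreconnected_of_eq_ofReal hD'o hD'c hx₀' (hSD.mono hsub)
      (hGD.mono hsub) fun t ht => ?_
    obtain ⟨ht0, ht1⟩ := ht
    simp only [Complex.ofReal_re] at ht0 ht1
    exact zudilin_nine h₀ t h₂ h₃ hh₀ ht0 hh₂ hh₃ (by linarith) h3lt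
  -- continuation to `D`
  have hEq : EqOn S G D :=
    (hSD.analyticOnNhd hDo).eqOn_of_preconnected_of_eventuallyEq (hGD.analyticOnNhd hDo) hDc (hsub hx₀')
      (Filter.eventuallyEq_of_mem (hD'o.mem_nhds hx₀') hEq')
  exact hEq (show ((h₁ : ℝ) : ℂ) ∈ D from ⟨by simp; linarith, by simp; linarith⟩)

/-! ### 5. The full positive range by symmetry, and the typed corollaries -/

/-- **Zudilin's (9) = Dougall's `₅F₄` sum in Gamma form on the full positive range**: for real
`h₀, h₁, h₂, h₃ > 0` with `h₁+h₂+h₃ < 1+h₀`,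
`Σ_μ (h₀+2μ)Γ(h₀+μ)Γ(h₁+μ)Γ(h₂+μ)Γ(h₃+μ)/(Γ(μ+1)Γ(h₀−h₁+1+μ)Γ(h₀−h₂+1+μ)Γ(h₀−h₃+1+μ))
 = Γ(h₁)Γ(h₂)Γ(h₃)Γ(h₀−h₁−h₂−h₃+1)/(Γ(h₀−h₁−h₂+1)Γ(h₀−h₁−h₃+1)Γ(h₀−h₂−h₃+1))`
(at most one of `h₁, h₂, h₃` reaches `(1+h₀)/2`; continue in that slot). [cite: Bailey1935, §4.4 (1)] -/
theorem zudilin_nine' (h₀ h₁ h₂ h₃ : ℝ) (hh₀ : 0 < h₀) (hh₁ : 0 < h₁) (hh₂ : 0 < h₂) (hh₃ : 0 < h₃)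
    (hs : h₁ + h₂ + h₃ < 1 + h₀) :
    ∑' μ : ℕ, ((h₀ : ℂ) + 2 * μ) *
        (Complex.Gamma ((h₀ : ℂ) + μ) * Complex.Gamma ((h₁ : ℂ) + μ) * Complex.Gamma ((h₂ : ℂ) + μ) *
          Complex.Gamma ((h₃ : ℂ) + μ)) /
        (Complex.Gamma ((μ : ℂ) + 1) * Complex.Gamma ((h₀ : ℂ) - h₁ + 1 + μ) * Complex.Gamma ((h₀ : ℂ) - h₂ + 1 + μ) *
          Complex.Gamma ((h₀ : ℂ) - h₃ + 1 + μ)) =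
      Complex.Gamma h₁ * Complex.Gamma h₂ * Complex.Gamma h₃ * Complex.Gamma ((h₀ : ℂ) - h₁ - h₂ - h₃ + 1) /
        (Complex.Gamma ((h₀ : ℂ) - h₁ - h₂ + 1) * Complex.Gamma ((h₀ : ℂ) - h₁ - h₃ + 1) *
          Complex.Gamma ((h₀ : ℂ) - h₂ - h₃ + 1)) := by
  by_cases H2 : 2 * h₂ < 1 + h₀
  · by_cases H3 : 2 * h₃ < 1 + h₀
    · exact zudilin_nine_of_lt h₀ h₂ h₃ hh₀ hh₂ hh₃ H2 H3 h₁ hh₁ hs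
    · rw [not_lt] at H3
      have H1 : 2 * h₁ < 1 + h₀ := by linarith
      have key := zudilin_nine_of_lt h₀ h₂ h₁ hh₀ hh₂ hh₁ H2 H1 h₃ hh₃ (by linarith)
      convert key using 1
      · exact tsum_congr fun μ => by ring
      · ring_nf
  · rw [not_lt] at H2
    have H1 : 2 * h₁ < 1 + h₀ := by linarith
    have H3 : 2 * h₃ < 1 + h₀ := by linarith
    have key := zudilin_nine_of_lt h₀ h₁ h₃ hh₀ hh₁ hh₃ H1 H3 h₂ hh₂ (by linarith)
    convert key using 1
    · exact tsum_congr fun μ => by ring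
    · ring_nf

/-- **The typed very-well-poised `F₃` in closed form, full positive range**: for `h : ℕ → ℝ` with `h 0, h 1, h 2, h 3 > 0`
and `h 1 + h 2 + h 3 < 1 + h 0`, `Zudilin2002.vwpSeries 3 h = Γ(h₁)Γ(h₂)Γ(h₃)Γ(h₀−h₁−h₂−h₃+1)/(Γ(h₀−h₁−h₂+1)Γ(h₀−h₁−h₃+1)
Γ(h₀−h₂−h₃+1))` (eq. (9) of Zudilin's note for the typed object). -/
theorem vwpSeries_three_eq' (h : ℕ → ℝ) (hh₀ : 0 < h 0) (hh₁ : 0 < h 1) (hh₂ : 0 < h 2) (hh₃ : 0 < h 3)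
    (hs : h 1 + h 2 + h 3 < 1 + h 0) :
    vwpSeries 3 h =
      Real.Gamma (h 1) * Real.Gamma (h 2) * Real.Gamma (h 3) * Real.Gamma (h 0 - h 1 - h 2 - h 3 + 1) /
        (Real.Gamma (h 0 - h 1 - h 2 + 1) * Real.Gamma (h 0 - h 1 - h 3 + 1) * Real.Gamma (h 0 - h 2 - h 3 + 1)) := by
  have key := zudilin_nine' (h 0) (h 1) (h 2) (h 3) hh₀ hh₁ hh₂ hh₃ hs
  apply Complex.ofReal_injective
  unfold vwpSeries
  rw [Complex.ofReal_tsum]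
  have hterm : ∀ μ : ℕ, (((h 0 + 2 * μ) *
        (∏ j ∈ Finset.range (3 + 1), Real.Gamma (h j + μ) / Real.Gamma (1 + h 0 - h j + μ)) *
        (-1 : ℝ) ^ ((3 + 1) * μ) : ℝ) : ℂ) =
      ((h 0 : ℂ) + 2 * μ) *
        (Complex.Gamma ((h 0 : ℂ) + μ) * Complex.Gamma ((h 1 : ℂ) + μ) * Complex.Gamma ((h 2 : ℂ) + μ) *
          Complex.Gamma ((h 3 : ℂ) + μ)) /
        (Complex.Gamma ((μ : ℂ) + 1) * Complex.Gamma ((h 0 : ℂ) - h 1 + 1 + μ) * Complex.Gamma ((h 0 : ℂ) - h 2 + 1 + μ) *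
          Complex.Gamma ((h 0 : ℂ) - h 3 + 1 + μ)) := by
    intro μ
    have hsign : (-1 : ℝ) ^ ((3 + 1) * μ) = 1 := by
      rw [show (3 + 1) * μ = 2 * (2 * μ) by ring, pow_mul, neg_one_sq, one_pow]
    rw [hsign, mul_one]
    simp only [Finset.prod_range_succ, Finset.prod_range_zero, one_mul]
    push_cast
    simp only [← Complex.Gamma_ofReal]
    push_cast
    rw [show (1 : ℂ) + (h 0 : ℂ) - (h 0 : ℂ) + (μ : ℂ) = (μ : ℂ) + 1 by ring,
      show (1 : ℂ) + (h 0 : ℂ) - (h 1 : ℂ) + (μ : ℂ) = (h 0 : ℂ) - h 1 + 1 + μ by ring,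
      show (1 : ℂ) + (h 0 : ℂ) - (h 2 : ℂ) + (μ : ℂ) = (h 0 : ℂ) - h 2 + 1 + μ by ring,
      show (1 : ℂ) + (h 0 : ℂ) - (h 3 : ℂ) + (μ : ℂ) = (h 0 : ℂ) - h 3 + 1 + μ by ring]
    ring
  rw [tsum_congr hterm, key]
  push_cast
  simp only [← Complex.Gamma_ofReal]
  push_cast
  ring_nf

/-- **The case `k = 1` of the typed `vwp_eq_integral_of_pos`** (natural hypotheses): for `h : ℕ → ℝ` with
`h 0, h 1, h 2, h 3 > 0` and `h 1 + h 2 + h 3 < 1 + h 0`,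
`(∏_{j ∈ Icc 1 2} Γ(1+h 0−h j−h (j+1)))/(Γ(h 1)Γ(h 3)) · vwpSeries 3 h = sorokinIntegral 1 (h 1) (h (·+2)) (1+h 0−h (·+3))`,
i.e. `Γ(1+h₀−h₁−h₂)Γ(1+h₀−h₂−h₃)/(Γ(h₁)Γ(h₃)) · F₃(h₀;h₁,h₂,h₃) = J₁(h₁; h₂ | 1+h₀−h₃)` — eqs. (9)–(11) of Zudilin's note. -/
theorem vwp_eq_integral_one (h : ℕ → ℝ) (hh₀ : 0 < h 0) (hh₁ : 0 < h 1) (hh₂ : 0 < h 2) (hh₃ : 0 < h 3)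
    (hs : h 1 + h 2 + h 3 < 1 + h 0) :
    (∏ j ∈ Finset.Icc 1 2, Real.Gamma (1 + h 0 - h j - h (j + 1))) / (Real.Gamma (h 1) * Real.Gamma (h 3)) *
        vwpSeries 3 h =
      sorokinIntegral 1 (h 1) (fun i => h (i + 2)) (fun i => 1 + h 0 - h (i + 3)) := by
  rw [vwpSeries_three_eq' h hh₀ hh₁ hh₂ hh₃ hs,
    ZudilinVWPBaseCase.sorokinIntegral_one_eq (h 1) (fun i => h (i + 2)) (fun i => 1 + h 0 - h (i + 3))
      (by simpa using hh₂) (by simp; linarith)]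
  have hI : Finset.Icc 1 2 = {1, 2} := by decide
  rw [hI, Finset.prod_insert (by decide), Finset.prod_singleton]
  have hΓ1 : Real.Gamma (h 1) ≠ 0 := (Real.Gamma_pos_of_pos hh₁).ne'
  have hΓ3 : Real.Gamma (h 3) ≠ 0 := (Real.Gamma_pos_of_pos hh₃).ne'
  have hΓ12 : Real.Gamma (h 0 - h 1 - h 2 + 1) ≠ 0 := (Real.Gamma_pos_of_pos (by linarith)).ne'
  have hΓ13 : Real.Gamma (h 0 - h 1 - h 3 + 1) ≠ 0 := (Real.Gamma_pos_of_pos (by linarith)).ne'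
  have hΓ23 : Real.Gamma (h 0 - h 2 - h 3 + 1) ≠ 0 := (Real.Gamma_pos_of_pos (by linarith)).ne'
  rw [show (1 + h 0 - h 1 - h (1 + 1)) = h 0 - h 1 - h 2 + 1 by norm_num; ring,
    show (1 + h 0 - h 2 - h (2 + 1)) = h 0 - h 2 - h 3 + 1 by norm_num; ring,
    show (1 + h 0 - h (0 + 3) - h (0 + 2) - h 1) = h 0 - h 1 - h 2 - h 3 + 1 by norm_num; ring,
    show (1 + h 0 - h (0 + 3) - h 1) = h 0 - h 1 - h 3 + 1 by norm_num; ring]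
  field_simp

/-- **The instance `k = 1` of `Literature.NumberTheory.Irrationality.Zudilin2002.vwp_eq_integral_of_pos`, verbatim**
(its hypotheses (5), (6) and the positivity conditions, specialised to `k = 1`; the last one, `h 1 + h 2 < 1 + h 0`, is
implied by (5) here and not used). -/
theorem vwp_eq_integral_of_pos_one (h : ℕ → ℝ)
    (h5 : (2 / ((1 : ℕ) + 1 : ℝ)) * (∑ j ∈ Finset.Icc 1 (1 + 2), h j) < 1 + h 0)
    (h6 : ∀ j ∈ Finset.Icc 2 (1 + 1), 0 < h j ∧ h j < 1 + h 0 - h (j + 1))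
    (hh₀ : 0 < h 0) (hh₁ : 0 < h 1) (hk : 0 < h (1 + 2)) (_h12 : h 1 + h 2 < 1 + h 0) :
    (∏ j ∈ Finset.Icc 1 (1 + 1), Real.Gamma (1 + h 0 - h j - h (j + 1))) /
          (Real.Gamma (h 1) * Real.Gamma (h (1 + 2))) * vwpSeries (1 + 2) h =
      sorokinIntegral 1 (h 1) (fun i => h (i + 2)) (fun i => 1 + h 0 - h (i + 3)) := by
  have hI : Finset.Icc 1 (1 + 2) = {1, 2, 3} := by decide
  rw [hI] at h5
  simp only [Finset.mem_insert, Finset.mem_singleton, OfNat.one_ne_ofNat, or_self, not_false_eq_true,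
    Finset.sum_insert, Nat.cast_one] at h5
  norm_num at h5
  have hh₂ : 0 < h 2 := (h6 2 (by decide)).1
  exact vwp_eq_integral_one h hh₀ hh₁ hh₂ hk (by linarith)

/-- **Reduction of the typed binder to `k ≥ 2`.**  Since the instance `k = 1` is `vwp_eq_integral_of_pos_one`, the named fact
`Literature.NumberTheory.Irrationality.Zudilin2002.vwp_eq_integral_of_pos` follows from its own restriction to `k ≥ 2`
(stated here as the hypothesis `H`, verbatim).  This discharges nothing: `H` is exactly the remaining debt (Zudilin's
induction (13)–(14), bricks B3/B4/B6 of the blueprint). -/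
theorem vwp_eq_integral_of_pos_of_two_le
    (H : ∀ (k : ℕ) (h : ℕ → ℝ), 2 ≤ k →
      (2 / ((k : ℝ) + 1)) * (∑ j ∈ Finset.Icc 1 (k + 2), h j) < 1 + h 0 →
      (∀ j ∈ Finset.Icc 2 (k + 1), 0 < h j ∧ h j < 1 + h 0 - h (j + 1)) →
      0 < h 0 → 0 < h 1 → 0 < h (k + 2) → h 1 + h 2 < 1 + h 0 →
      (∏ j ∈ Finset.Icc 1 (k + 1), Real.Gamma (1 + h 0 - h j - h (j + 1))) /
            (Real.Gamma (h 1) * Real.Gamma (h (k + 2))) * vwpSeries (k + 2) h =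
        sorokinIntegral k (h 1) (fun i => h (i + 2)) (fun i => 1 + h 0 - h (i + 3))) :
    Literature.NumberTheory.Irrationality.Zudilin2002.vwp_eq_integral_of_pos := by
  intro k h hk h5 h6 hh₀ hh₁ hk2 h12
  rcases (show k = 1 ∨ 2 ≤ k by omega) with rfl | hk'
  · exact vwp_eq_integral_of_pos_one h h5 h6 hh₀ hh₁ hk2 h12
  · exact H k h hk' h5 h6 hh₀ hh₁ hk2 h12

end Summit.KontsevichZagierPeriods.Zeta5Search.DougallFullRange

end
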